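import Summits.Parity.BatemanHorn.Theorems.SelbergDelangeRigidityDefs
import Literature.NumberTheory.Sieve.ParityWave0BunyakovskyProofs
import HarnessLib

/-!
# Route `SelbergDelangeRigidity`, crux `LSDRealSegment` (stmt-Parity-9770), line
# `product-anatomy-subcritical`: the Type-I sandwich (helper of `stub_typeI`)

For a Bateman–Horn system `f`, real `y ≥ 1` and the Type-I sum
`T_x(y) = typeISum f y x = Σ_{0 ≤ n ≤ x} Σ_{d ∣ P(n), d ≤ x} g_y(d)` (`P(n) = prodVal f n`, `g_y = omegaWeight y ≥ 0`):
`|T_x(y) − x Σ_{d ≤ x} g_y(d) ρ_F(d)/d| ≤ C (1 + Σ_{d ≤ x} g_y(d) ρ_F(d))` (`typeI_sandwich`, the registered helper),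
`ρ_F(d) = polyRootCountMod f d = #{n mod d : d ∣ ∏ fᵢ(n)}`.

Proof (Fubini + complete residue systems): let `n₀` be such that every `fᵢ(n) ≥ 1` for `n ≥ n₀`
(`Literature.NumberTheory.Sieve.tendsto_eval_natCast_atTop`).  For `n ≥ n₀`, `P(n) = ∏ fᵢ(n)` and
`d ∣ P(n) ↔ d ∣ ∏ fᵢ(n)` in `ℤ`, a `d`-PERIODIC condition in `n` (`Polynomial.sub_dvd_eval_sub`); so swapping the sums,
the rows `n ∈ [n₀, x]` contribute `Σ_{d ≤ x} g_y(d) N_d` with `N_d = #{n ∈ [n₀, x] : d ∣ ∏ fᵢ(n)}`,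
`|N_d − (x + 1 − n₀) ρ_F(d)/d| ≤ ρ_F(d)` (full periods, `Nat.filter_Ico_card_eq_of_periodic`), whence
`|N_d − x ρ_F(d)/d| ≤ (n₀ + 2) ρ_F(d)`; the rows `n < n₀` contribute between `0` and the constant
`Σ_{n < n₀} Σ_{d ∣ P(n)} g_y(d)` (all weights are `≥ 0` because `y ≥ 1` — for `y < 1` the sandwich fails, cf.
`Theorems/SystemLSDRealSegment/Negative/TypeISandwichNeedsOneLe.lean` on the sibling line).
-/

open Filter Finset Polynomial
open scoped BigOperators Topology Classical

namespace Summit.Parity.BatemanHorn.Cruxes.LSDRealSegment.ProductAnatomySubcritical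

open Literature.NumberTheory.Sieve
open ArithmeticFunction (cardFactors)
noncomputable section

variable {k : ℕ}

/-! ### Counting a periodic condition on an interval -/

/-- Full periods from any starting point: a `d`-periodic condition holds on `[a, a + q d)` exactly
`q · #{t < d : P t}` times. [folklore] -/
theorem card_filter_Ico_add_mul (P : ℕ → Prop) [DecidablePred P] {d : ℕ} (hP : Function.Periodic P d)
    (a q : ℕ) : #((Ico a (a + q * d)).filter P) = q * #((range d).filter P) := by
  induction q with
  | zero => simp
  | succ q ih =>
    have hsplit : Ico a (a + (q + 1) * d) = Ico a (a + q * d) ∪ Ico (a + q * d) (a + q * d + d) := by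
      rw [add_mul, one_mul, ← add_assoc]
      exact (Finset.Ico_union_Ico_eq_Ico (by omega) (by omega)).symm
    rw [hsplit, Finset.filter_union, Finset.card_union_of_disjoint
        (Finset.disjoint_filter_filter (Finset.Ico_disjoint_Ico_consecutive _ _ _)), ih,
      Nat.filter_Ico_card_eq_of_periodic _ _ P hP, Nat.count_eq_card_filter_range, add_mul, one_mul]

/-- A `d`-periodic condition (`d ≥ 1`) holds on an interval of length `ℓ` for `ℓ ρ / d + θ ρ` integers with
`|θ| ≤ 1`, where `ρ = #{t < d : P t}`. [folklore] -/
theorem abs_card_filter_Ico_sub_le (P : ℕ → Prop) [DecidablePred P] {d : ℕ} (hd : 0 < d)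
    (hP : Function.Periodic P d) (a ℓ : ℕ) :
    |(#((Ico a (a + ℓ)).filter P) : ℝ) - (ℓ : ℝ) * #((range d).filter P) / d| ≤ #((range d).filter P) := by
  set ρ := #((range d).filter P) with hρ
  set q := ℓ / d with hq
  have hqd : q * d ≤ ℓ := Nat.div_mul_le_self ℓ d
  have hqd' : ℓ < q * d + d := Nat.lt_div_mul_add hd
  have hlow : q * ρ ≤ #((Ico a (a + ℓ)).filter P) := by
    rw [← card_filter_Ico_add_mul P hP a q]
    exact Finset.card_le_card (Finset.filter_subset_filter _ (Finset.Ico_subset_Ico_right (by omega)))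
  have hupp : #((Ico a (a + ℓ)).filter P) ≤ (q + 1) * ρ := by
    rw [← card_filter_Ico_add_mul P hP a (q + 1)]
    refine Finset.card_le_card (Finset.filter_subset_filter _ (Finset.Ico_subset_Ico_right ?_))
    have : (q + 1) * d = q * d + d := by ring
    omega
  have hd' : (0 : ℝ) < d := by exact_mod_cast hd
  have hq1 : (q : ℝ) * d ≤ ℓ := by exact_mod_cast hqd
  have hq2 : (ℓ : ℝ) ≤ (q + 1) * d := by
    have : ((q * d + d : ℕ) : ℝ) = ((q : ℝ) + 1) * d := by push_cast; ring
    rw [← this]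
    exact_mod_cast hqd'.le
  have hlow' : (q : ℝ) * ρ ≤ #((Ico a (a + ℓ)).filter P) := by exact_mod_cast hlow
  have hupp' : (#((Ico a (a + ℓ)).filter P) : ℝ) ≤ ((q : ℝ) + 1) * ρ := by exact_mod_cast hupp
  have hρ0 : (0 : ℝ) ≤ ρ := Nat.cast_nonneg _
  have h1 : (q : ℝ) * ρ ≤ ℓ * ρ / d := by
    rw [le_div_iff₀ hd']
    nlinarith
  have h2 : (ℓ : ℝ) * ρ / d ≤ (q + 1) * ρ := by
    rw [div_le_iff₀ hd']
    nlinarith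
  rw [abs_le]
  constructor <;> linarith

/-! ### The product value for `n ≥ n₀` -/

/-- For a Bateman–Horn system all values `fᵢ(n)` are eventually `≥ 1`. [folklore] -/
theorem exists_forall_one_le_eval {f : Fin k → ℤ[X]} (hf : IsBatemanHornSystem f) :
    ∃ n₀ : ℕ, ∀ n, n₀ ≤ n → ∀ i, (1 : ℤ) ≤ (f i).eval (n : ℤ) := by
  have h : ∀ᶠ n : ℕ in atTop, ∀ i, (1 : ℤ) ≤ (f i).eval (n : ℤ) :=
    Filter.eventually_all.mpr fun i =>
      (tendsto_eval_natCast_atTop (Nat.succ_le_of_lt (hf.natDegree_pos i))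
        (hf.leadingCoeff_pos i)).eventually_ge_atTop 1
  exact Filter.eventually_atTop.mp h

/-- When all `fᵢ(n) ≥ 1`: `P(n) = ∏ fᵢ(n)` as integers. [folklore] -/
theorem natCast_prodVal_eq {f : Fin k → ℤ[X]} {n : ℕ} (hn : ∀ i, (1 : ℤ) ≤ (f i).eval (n : ℤ)) :
    (prodVal f n : ℤ) = ∏ i, (f i).eval (n : ℤ) := by
  unfold prodVal
  rw [Nat.cast_prod]
  refine Finset.prod_congr rfl fun i _ => ?_
  have h := hn i
  rw [max_eq_left (by omega), Int.toNat_of_nonneg (by omega)]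

/-- When all `fᵢ(n) ≥ 1`: `d ∣ P(n) ↔ d ∣ ∏ fᵢ(n)` in `ℤ`. [folklore] -/
theorem dvd_prodVal_iff {f : Fin k → ℤ[X]} {n : ℕ} (hn : ∀ i, (1 : ℤ) ≤ (f i).eval (n : ℤ)) (d : ℕ) :
    d ∣ prodVal f n ↔ (d : ℤ) ∣ ∏ i, (f i).eval (n : ℤ) := by
  rw [← natCast_prodVal_eq hn, Int.natCast_dvd_natCast]

/-- `n ↦ [d ∣ ∏ fᵢ(n)]` is `d`-periodic (`(a − b) ∣ F(a) − F(b)`). [folklore] -/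
theorem periodic_dvd_prod_eval (f : Fin k → ℤ[X]) (d : ℕ) :
    Function.Periodic (fun n : ℕ => (d : ℤ) ∣ ∏ i, (f i).eval (n : ℤ)) d := by
  intro n
  simp only [eq_iff_iff]
  have h : ((n + d : ℕ) : ℤ) - (n : ℤ) ∣ (∏ i, f i).eval ((n + d : ℕ) : ℤ) - (∏ i, f i).eval (n : ℤ) :=
    Polynomial.sub_dvd_eval_sub _ _ _
  rw [Polynomial.eval_prod, Polynomial.eval_prod, show ((n + d : ℕ) : ℤ) - (n : ℤ) = d by push_cast; ring] at h
  exact dvd_iff_dvd_of_dvd_sub h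

/-- For `n ≥ n₀` the truncated divisor sum over `P(n)` is a sum over `d ≤ x` of the periodic indicator. [folklore] -/
theorem sum_divisors_filter_eq {f : Fin k → ℤ[X]} {n : ℕ} (hn : ∀ i, (1 : ℤ) ≤ (f i).eval (n : ℤ))
    (w : ℕ → ℝ) (x : ℕ) :
    ∑ d ∈ (prodVal f n).divisors.filter (fun d => d ≤ x), w d =
      ∑ d ∈ Icc 1 x, if (d : ℤ) ∣ ∏ i, (f i).eval (n : ℤ) then w d else 0 := by
  rw [← Finset.sum_filter]
  refine Finset.sum_congr ?_ fun _ _ => rfl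
  ext d
  simp only [Finset.mem_filter, Nat.mem_divisors, Finset.mem_Icc, ← dvd_prodVal_iff hn d]
  constructor
  · rintro ⟨⟨hd, h0⟩, hdx⟩
    exact ⟨⟨Nat.pos_of_dvd_of_pos hd (Nat.pos_of_ne_zero h0), hdx⟩, hd⟩
  · rintro ⟨⟨-, hdx⟩, hd⟩
    exact ⟨⟨hd, prodVal_ne_zero f n⟩, hdx⟩

/-! ### The registered helper -/

/-- **typeI_sandwich** (registered helper of `stub_typeI`, line `product-anatomy-subcritical`): for a
Bateman–Horn system `f` and real `y ≥ 1`,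
`|T_x(y) − x Σ_{1 ≤ d ≤ x} g_y(d) ρ_F(d)/d| ≤ C (1 + Σ_{1 ≤ d ≤ x} g_y(d) ρ_F(d))` for all `x`
(`T_x = typeISum f y x`, `g_y = omegaWeight y`, `ρ_F = polyRootCountMod f`; Fubini over `d`, periodicity of
`d ∣ ∏ fᵢ(n)` in `n`, complete residue systems on `[n₀, x]`, and the `n < n₀` rows bounded by a constant since all
weights are non-negative). [folklore] -/
theorem typeI_sandwich : ∀ (k : ℕ) (f : Fin k → ℤ[X]), IsBatemanHornSystem f → ∀ y : ℝ, 1 ≤ y →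
    ∃ C : ℝ, ∀ x : ℕ,
      |typeISum f y x - (x : ℝ) * ∑ m ∈ Icc 1 x, omegaWeight y m * (polyRootCountMod f m : ℝ) / m| ≤
        C * (1 + ∑ m ∈ Icc 1 x, omegaWeight y m * (polyRootCountMod f m : ℝ)) := by
  intro k f hf y hy
  obtain ⟨n₀, hn₀⟩ := exists_forall_one_le_eval hf
  have hw0 : ∀ d, 0 ≤ omegaWeight y d := fun d => by
    unfold omegaWeight Finsupp.prod
    refine Finset.prod_nonneg fun p _ => ?_
    cases (d.factorization p) with
    | zero => simp
    | succ a => exact mul_nonneg (by linarith) (pow_nonneg (by linarith) _)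
  -- the constant from the rows `n < n₀`
  set C₀ : ℝ := ∑ n ∈ range n₀, ∑ d ∈ (prodVal f n).divisors, omegaWeight y d with hC₀
  have hC₀0 : 0 ≤ C₀ := Finset.sum_nonneg fun n _ => Finset.sum_nonneg fun d _ => hw0 d
  refine ⟨C₀ + (n₀ + 2), fun x => ?_⟩
  set H : ℝ := ∑ m ∈ Icc 1 x, omegaWeight y m * (polyRootCountMod f m : ℝ) with hH
  have hH0 : 0 ≤ H := Finset.sum_nonneg fun m _ => mul_nonneg (hw0 m) (Nat.cast_nonneg _)
  -- split the rows at `n₀`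
  have hT : typeISum f y x =
      (∑ n ∈ (range (x + 1)).filter (fun n => n < n₀),
        ∑ d ∈ (prodVal f n).divisors.filter (fun d => d ≤ x), omegaWeight y d) +
      ∑ n ∈ Ico n₀ (x + 1), ∑ d ∈ (prodVal f n).divisors.filter (fun d => d ≤ x), omegaWeight y d := by
    unfold typeISum
    rw [← Finset.sum_filter_add_sum_filter_not (range (x + 1)) (fun n => n < n₀)]
    congr 1
    refine Finset.sum_congr ?_ fun _ _ => rfl
    ext n
    simp only [Finset.mem_filter, Finset.mem_range, Finset.mem_Ico]
    omega
  -- the rows `n < n₀`: between `0` and `C₀`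
  have hT1 : 0 ≤ ∑ n ∈ (range (x + 1)).filter (fun n => n < n₀),
        ∑ d ∈ (prodVal f n).divisors.filter (fun d => d ≤ x), omegaWeight y d ∧
      ∑ n ∈ (range (x + 1)).filter (fun n => n < n₀),
        ∑ d ∈ (prodVal f n).divisors.filter (fun d => d ≤ x), omegaWeight y d ≤ C₀ := by
    refine ⟨Finset.sum_nonneg fun n _ => Finset.sum_nonneg fun d _ => hw0 d, ?_⟩
    calc ∑ n ∈ (range (x + 1)).filter (fun n => n < n₀),
          ∑ d ∈ (prodVal f n).divisors.filter (fun d => d ≤ x), omegaWeight y d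
        ≤ ∑ n ∈ range n₀, ∑ d ∈ (prodVal f n).divisors.filter (fun d => d ≤ x), omegaWeight y d := by
          refine Finset.sum_le_sum_of_subset_of_nonneg (fun n hn => ?_) fun n _ _ =>
            Finset.sum_nonneg fun d _ => hw0 d
          rw [Finset.mem_filter] at hn
          exact Finset.mem_range.mpr hn.2
      _ ≤ C₀ := Finset.sum_le_sum fun n _ =>
          Finset.sum_le_sum_of_subset_of_nonneg (Finset.filter_subset _ _) fun d _ _ => hw0 d
  -- the rows `n ≥ n₀`: Fubini
  have hT2 : ∑ n ∈ Ico n₀ (x + 1), ∑ d ∈ (prodVal f n).divisors.filter (fun d => d ≤ x), omegaWeight y d =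
      ∑ d ∈ Icc 1 x, omegaWeight y d *
        (#((Ico n₀ (x + 1)).filter fun n : ℕ => (d : ℤ) ∣ ∏ i, (f i).eval (n : ℤ)) : ℝ) := by
    rw [Finset.sum_congr rfl fun n hn =>
      sum_divisors_filter_eq (hn₀ n (Finset.mem_Ico.mp hn).1) (omegaWeight y) x, Finset.sum_comm]
    refine Finset.sum_congr rfl fun d _ => ?_
    rw [← Finset.sum_filter, Finset.sum_const, nsmul_eq_mul, mul_comm]
  -- the count on `[n₀, x]` against `x ρ_F(d)/d`
  have hcount : ∀ d ∈ Icc 1 x,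
      |(#((Ico n₀ (x + 1)).filter fun n : ℕ => (d : ℤ) ∣ ∏ i, (f i).eval (n : ℤ)) : ℝ) -
        (x : ℝ) * (polyRootCountMod f d : ℝ) / d| ≤ (n₀ + 2) * (polyRootCountMod f d : ℝ) := by
    intro d hd
    have hd1 : 1 ≤ d := (Finset.mem_Icc.mp hd).1
    have hd0 : (0 : ℝ) < d := by exact_mod_cast hd1
    set ρ : ℝ := (polyRootCountMod f d : ℝ) with hρ
    have hρ0 : 0 ≤ ρ := Nat.cast_nonneg _
    have hρ' : (#((range d).filter fun n : ℕ => (d : ℤ) ∣ ∏ i, (f i).eval (n : ℤ)) : ℝ) = ρ := rfl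
    -- full periods on `[n₀, n₀ + ℓ)`, `ℓ = x + 1 - n₀`
    have hper := abs_card_filter_Ico_sub_le (fun n : ℕ => (d : ℤ) ∣ ∏ i, (f i).eval (n : ℤ)) hd1
      (periodic_dvd_prod_eval f d) n₀ (x + 1 - n₀)
    rw [hρ'] at hper
    have hIco : Ico n₀ (n₀ + (x + 1 - n₀)) = Ico n₀ (x + 1) := by
      rcases le_or_gt n₀ (x + 1) with h | h
      · rw [Nat.add_sub_cancel' h]
      · rw [Nat.sub_eq_zero_of_le h.le, add_zero, Finset.Ico_self, eq_comm, Finset.Ico_eq_empty_iff]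
        omega
    rw [hIco] at hper
    -- `|x - ℓ| ≤ n₀ + 1`
    have hℓ : |((x + 1 - n₀ : ℕ) : ℝ) - (x : ℝ)| ≤ n₀ + 1 := by
      rcases le_or_gt n₀ (x + 1) with h | h
      · rw [Nat.cast_sub h]
        push_cast
        rw [abs_le]
        constructor <;> linarith [(Nat.cast_nonneg n₀ : (0 : ℝ) ≤ n₀)]
      · rw [Nat.sub_eq_zero_of_le h.le]
        have hx : (x : ℝ) ≤ n₀ := by exact_mod_cast (by omega : x ≤ n₀)
        rw [abs_le]
        constructor <;> push_cast <;> linarith [(Nat.cast_nonneg x : (0 : ℝ) ≤ x)]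
    have key : ∀ Nd ℓ : ℝ, |Nd - ℓ * ρ / d| ≤ ρ → |ℓ - x| ≤ n₀ + 1 → |Nd - x * ρ / d| ≤ (n₀ + 2) * ρ := by
      intro Nd ℓ h1 h2
      rw [show Nd - x * ρ / d = (Nd - ℓ * ρ / d) + (ℓ - x) * (ρ / d) by ring]
      refine (abs_add_le _ _).trans ?_
      rw [abs_mul, abs_of_nonneg (div_nonneg hρ0 hd0.le)]
      have hρd : ρ / d ≤ ρ := div_le_self hρ0 (by exact_mod_cast hd1)
      calc |Nd - ℓ * ρ / d| + |ℓ - x| * (ρ / d) ≤ ρ + (n₀ + 1) * (ρ / d) :=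
            add_le_add h1 (mul_le_mul_of_nonneg_right h2 (div_nonneg hρ0 hd0.le))
        _ ≤ ρ + (n₀ + 1) * ρ := by gcongr
        _ = (n₀ + 2) * ρ := by ring
    exact key _ _ hper hℓ
  -- assemble
  have hmain : |(∑ d ∈ Icc 1 x, omegaWeight y d *
        (#((Ico n₀ (x + 1)).filter fun n : ℕ => (d : ℤ) ∣ ∏ i, (f i).eval (n : ℤ)) : ℝ)) -
      (x : ℝ) * ∑ m ∈ Icc 1 x, omegaWeight y m * (polyRootCountMod f m : ℝ) / m| ≤ (n₀ + 2) * H := by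
    rw [Finset.mul_sum, ← Finset.sum_sub_distrib]
    have e : ∀ d ∈ Icc 1 x, omegaWeight y d *
          (#((Ico n₀ (x + 1)).filter fun n : ℕ => (d : ℤ) ∣ ∏ i, (f i).eval (n : ℤ)) : ℝ) -
        (x : ℝ) * (omegaWeight y d * (polyRootCountMod f d : ℝ) / d) =
        omegaWeight y d * ((#((Ico n₀ (x + 1)).filter fun n : ℕ => (d : ℤ) ∣ ∏ i, (f i).eval (n : ℤ)) : ℝ) -
          (x : ℝ) * (polyRootCountMod f d : ℝ) / d) := by
      intro d _
      ring
    rw [Finset.sum_congr rfl e]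
    refine (Finset.abs_sum_le_sum_abs _ _).trans ?_
    rw [hH, Finset.mul_sum]
    refine Finset.sum_le_sum fun d hd => ?_
    rw [abs_mul, abs_of_nonneg (hw0 d)]
    calc omegaWeight y d * |(#((Ico n₀ (x + 1)).filter fun n : ℕ => (d : ℤ) ∣ ∏ i, (f i).eval (n : ℤ)) : ℝ) -
          (x : ℝ) * (polyRootCountMod f d : ℝ) / d|
        ≤ omegaWeight y d * ((n₀ + 2) * (polyRootCountMod f d : ℝ)) :=
          mul_le_mul_of_nonneg_left (hcount d hd) (hw0 d)
      _ = (n₀ + 2) * (omegaWeight y d * (polyRootCountMod f d : ℝ)) := by ring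
  rw [hT, hT2, add_sub_assoc]
  calc |(∑ n ∈ (range (x + 1)).filter (fun n => n < n₀),
          ∑ d ∈ (prodVal f n).divisors.filter (fun d => d ≤ x), omegaWeight y d) +
        ((∑ d ∈ Icc 1 x, omegaWeight y d *
          (#((Ico n₀ (x + 1)).filter fun n : ℕ => (d : ℤ) ∣ ∏ i, (f i).eval (n : ℤ)) : ℝ)) -
          (x : ℝ) * ∑ m ∈ Icc 1 x, omegaWeight y m * (polyRootCountMod f m : ℝ) / m)|
      ≤ |∑ n ∈ (range (x + 1)).filter (fun n => n < n₀),
          ∑ d ∈ (prodVal f n).divisors.filter (fun d => d ≤ x), omegaWeight y d| +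
        |(∑ d ∈ Icc 1 x, omegaWeight y d *
          (#((Ico n₀ (x + 1)).filter fun n : ℕ => (d : ℤ) ∣ ∏ i, (f i).eval (n : ℤ)) : ℝ)) -
          (x : ℝ) * ∑ m ∈ Icc 1 x, omegaWeight y m * (polyRootCountMod f m : ℝ) / m| := abs_add_le _ _
    _ ≤ C₀ + (n₀ + 2) * H := by
        rw [abs_of_nonneg hT1.1]
        exact add_le_add hT1.2 hmain
    _ ≤ (C₀ + (n₀ + 2)) * (1 + H) := by nlinarith

end

end Summit.Parity.BatemanHorn.Cruxes.LSDRealSegment.ProductAnatomySubcritical
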